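import Mathlib
import Summits.QuantumFields.YangMills.Theorems.CoarseStiffnessTailCappedCoarseStiffnessLIteratedProp1
import Summits.QuantumFields.YangMills.Theorems.CoarseStiffnessTailCappedCoarseStiffnessLBareUniformCount

/-!
# Route `CoarseStiffnessTail` — JOINT PEIERLS FOR FAMILIES OF BLOCK-AVERAGED PLAQUETTES OF THE INTERACTING WILSON LAW AT A FIXED DEPTH,
# uniformly in the volume and the cut-off (lead's certificate, seat `ym-line-cst-p1` g13; helper on crux stmt-QuantumFields-25301, file 2 of 3)

THE POINT.  File 1 (`…LIteratedProp1`) converts a `θ`-large plaquette of the `j`-fold averaged field `Ū^j` into a `θ/C₁^j`-large FINE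
plaquette whose `j`-fold block is within coordinatewise offset `j` of the corner (`C₁ = 151L²`).  THIS FILE turns that into a JOINT
PEIERLS BOUND for arbitrary finite families `S` of level-`j` plaquettes under the Wilson–Gibbs law `Gibbs_K` of Bałaban's `SU(2)` tori:

* §1 counting on the tori (definition-free): **`card_near_le`** — at most `(2r+1)^d` sites within coordinatewise offset `r` of a site;
  **`card_fibre_blockIter`** — exactly `L^{d·k}` fine sites in a `k`-fold block (standing range); **`card_plaq_src_mem_le`** — at most
  `#pairs · #X` plaquettes based in a set `X` of sites;
* §2 ★ **`measureReal_forall_le_of_transfer`** — the abstract union bound: if every `S`-member's event forces the event of SOME related fine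
  object (at most `R` related objects per member, each fine object related to at most `M` members) and the fine events obey a joint bound
  `ρ^{#T}` for all finite `T` (`0 ≤ ρ ≤ 1`), then the joint `S`-event has mass `≤ R^{#S}·ρ^{#S/M}` — choice functions `f ∈ S.pi(regions)`,
  `Finset.card_le_mul_card_image` for the fibres, `measureReal_biUnion_finset_le`;
* §3 ★★ **`gibbsK_real_forall_avg_ge_le`** — for every family `F`, coupling `0 < γ ≤ 1`, cut-off `K`, depth `j ≤ K`, threshold
  `θ ≥ 0` with `(5L)²θ/4 < δ₂` and every finite family `S` of level-`j` plaquettes: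
  `Gibbs_K{∀ a ∈ S, θ ≤ |Ū^j(∂a) − 1|} ≤ (3(2j+1)³L^{3j})^{#S} · (min δ(β_K, θ/C₁^j) 1)^{#S/(9(2j+1)³)}`,
  `δ(β, ϑ) = 2e^{24}c⁻³(√β)^9 e^{−βϑ²/4}` the tree's single-plaquette Peierls–chessboard factor (`T3FinestHeightJointTail`, g9).

READING (line card §g13).  With `β_Kθ(K−j)² = L^j p(g_{K−j})²` the exponent per member is `−p(g_{K−j})²·L^j/(36(2j+1)³C₁^{2j})` up to the
Haar entropy `(9/2)log β_K` and the region entropy `log(3(2j+1)³L^{3j})`, both beaten by the profile once `γ ≤ γ₁(j, L, b₀)` (file 3,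
`…LEdgeBoundedDepth`): a rate GEOMETRICALLY DECAYING IN THE DEPTH.  The EDGE stub asks for NO decay; that is its located content.

HONEST SCOPE.  Elementary; composed from tree theorems by name (reflection positivity enters only through the cited fine-level joint tail);
nothing of Bałaban's estimates is proved; the crux 25301 and `HistoryTailL` 19936 stay OPEN; `YM3TorusSU2` (rung R3, a RECORD rung, not the Clay
statement) is NOT proved; the Yang–Mills mass gap is NOT touched.

References: J. Fröhlich, R. Israel, E. Lieb, B. Simon, CMP **62** (1978) 1–34 [FrohlichIsraelLiebSimon1978] (Thm 4.1); T. Bałaban, CMP **98**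
(1985) 17–51 [Balaban1985Averaging] (Prop. 1 (51) p.26); CMP **102** (1985) 255–275 [Balaban1985UV3] ((7) p.257, (38)–(40) p.266, (71) p.273).
-/

noncomputable section

namespace Summit.QuantumFields.YangMills.Theorems.CoarseStiffnessTailAveragedJointPeierls

open MeasureTheory Finset
open Literature.MathematicalPhysics.QuantumFieldTheory
open Literature.MathematicalPhysics.QuantumFieldTheory.Balaban1983to89
open Literature.MathematicalPhysics.QuantumFieldTheory.Balaban1983to89.B14.Eq22Determines (blockIter blockIter_succ blockIter_zero)
open Literature.MathematicalPhysics.QuantumFieldTheory.Balaban1983to89.BlockAveraging (avgFun blockAvg blockAvg_avg)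
open Literature.MathematicalPhysics.QuantumFieldTheory.Balaban1983to89.ExpMeanLog (expMeanLogSU deltaSU deltaSU_pos)
open Literature.MathematicalPhysics.QuantumFieldTheory.Balaban1983to89.T3ContinuumYM3Torus
open Literature.MathematicalPhysics.QuantumFieldTheory.Balaban1983to89.T3UnitScaleTilt
open Literature.MathematicalPhysics.QuantumFieldTheory.Balaban1983to89.T3UnitLawDensityEML
open Summit.QuantumFields.YangMills.Theorems.CoarseStiffnessTailIteratedProp1

/-! ## §1 Counting on the tori -/

section Counting

variable {P : Params}

open scoped Classical in
/-- **AT MOST `(2r+1)^d` SITES WITHIN COORDINATEWISE OFFSET `r` OF A SITE** (each coordinate offset ranges over `{−r, …, r}`; on a small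
torus offsets may coincide, which only lowers the count). [folklore] -/
theorem card_near_le {i : ℕ} (y : Site P i) (r : ℕ) :
    (univ.filter (fun z : Site P i => ∀ κ, ∃ t : ℤ, |t| ≤ (r : ℤ) ∧ z κ = y κ + (t : ZMod (P.sitesPerDir i)))).card ≤
      (2 * r + 1) ^ P.d := by
  classical
  -- the parametrisation by offset vectors
  let g : (Fin P.d → Fin (2 * r + 1)) → Site P i := fun f κ => y κ + ((((f κ : ℕ) : ℤ) - r : ℤ) : ZMod (P.sitesPerDir i))
  have hsub : univ.filter (fun z : Site P i => ∀ κ, ∃ t : ℤ, |t| ≤ (r : ℤ) ∧ z κ = y κ + (t : ZMod (P.sitesPerDir i))) ⊆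
      univ.image g := by
    intro z hz
    rw [mem_filter] at hz
    choose t ht using hz.2
    refine mem_image.mpr ⟨fun κ => ⟨(t κ + r).toNat, ?_⟩, mem_univ _, ?_⟩
    · have h1 := (abs_le.mp (ht κ).1).1
      have h2 := (abs_le.mp (ht κ).1).2
      omega
    · funext κ
      have h1 := (abs_le.mp (ht κ).1).1
      have hnat : (((t κ + r).toNat : ℕ) : ℤ) = t κ + r := Int.toNat_of_nonneg (by linarith)
      simp only [g, hnat, add_sub_cancel_right]
      exact (ht κ).2.symm
  calc (univ.filter _).card ≤ (univ.image g).card := card_le_card hsub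
    _ ≤ (univ : Finset (Fin P.d → Fin (2 * r + 1))).card := card_image_le
    _ = (2 * r + 1) ^ P.d := by simp

/-- Coordinatewise nearness is symmetric (`t ↦ −t`). [folklore] -/
theorem near_symm {i : ℕ} {y z : Site P i} {r : ℕ}
    (h : ∀ κ, ∃ t : ℤ, |t| ≤ (r : ℤ) ∧ z κ = y κ + (t : ZMod (P.sitesPerDir i))) :
    ∀ κ, ∃ t : ℤ, |t| ≤ (r : ℤ) ∧ y κ = z κ + (t : ZMod (P.sitesPerDir i)) := by
  intro κ
  obtain ⟨t, ht, hz⟩ := h κ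
  exact ⟨-t, by rwa [abs_neg], by rw [hz]; push_cast; ring⟩

open scoped Classical in
/-- **EXACTLY `L^{d·k}` FINE SITES IN A `k`-FOLD BLOCK** (standing range `k ≤ m + K`): the blocks of order `1` have `L^d` sites
(`Site.card_block`) and the `(k+1)`-fold block over `z` is the disjoint union of the `k`-fold blocks over the sites of `B(z)`.
[cite: Balaban1987RG1, (0.3) p.252] -/
theorem card_fibre_blockIter : ∀ (k : ℕ), k ≤ P.m + P.K → ∀ z : Site P k,
    (univ.filter (fun x : Site P 0 => blockIter k x = z)).card = P.L ^ (P.d * k) := by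
  classical
  intro k
  induction k with
  | zero =>
    intro _ z
    have : univ.filter (fun x : Site P 0 => blockIter 0 x = z) = {z} := by
      ext x; simp [blockIter_zero]
    rw [this, card_singleton, mul_zero, pow_zero]
  | succ k ih =>
    intro hk z
    have hmaps : ((univ.filter (fun x : Site P 0 => blockIter (k + 1) x = z) : Finset (Site P 0)) : Set (Site P 0)).MapsTo
        (blockIter k) (block z) := by
      intro x hx
      rw [Finset.mem_coe, mem_filter] at hx
      rw [Finset.mem_coe, block, mem_filter]
      exact ⟨mem_univ _, by rw [← blockIter_succ]; exact hx.2⟩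
    rw [card_eq_sum_card_fiberwise hmaps]
    have hfib : ∀ w ∈ block z, ((univ.filter (fun x : Site P 0 => blockIter (k + 1) x = z)).filter
        (fun x => blockIter k x = w)).card = P.L ^ (P.d * k) := by
      intro w hw
      rw [block, mem_filter] at hw
      rw [← ih (by omega) w]
      congr 1
      ext x
      simp only [mem_filter, mem_univ, true_and]
      constructor
      · exact fun h => h.2
      · intro h; exact ⟨by rw [blockIter_succ, h, hw.2], h⟩
    rw [sum_congr rfl hfib, sum_const, Site.card_block hk z, smul_eq_mul, ← pow_add]
    congr 1; ring

open scoped Classical in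
/-- **AT MOST `#pairs · #X` PLAQUETTES ARE BASED IN A SET `X` OF SITES** (a plaquette is its corner and an ordered pair `μ < ν`). [folklore] -/
theorem card_plaq_src_mem_le {i : ℕ} (X : Finset (Site P i)) :
    (univ.filter (fun q : Plaq P i => q.src ∈ X)).card ≤
      Fintype.card {μν : Fin P.d × Fin P.d // μν.1 < μν.2} * X.card := by
  classical
  let g : {μν : Fin P.d × Fin P.d // μν.1 < μν.2} × Site P i → Plaq P i := fun t => ⟨t.2, t.1.1.1, t.1.1.2, t.1.2⟩
  have hsub : univ.filter (fun q : Plaq P i => q.src ∈ X) ⊆ (univ ×ˢ X).image g := by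
    intro q hq
    rw [mem_filter] at hq
    refine mem_image.mpr ⟨(⟨(q.μ, q.ν), q.hμν⟩, q.src), mem_product.mpr ⟨mem_univ _, hq.2⟩, ?_⟩
    rfl
  calc (univ.filter _).card ≤ ((univ ×ˢ X).image g).card := card_le_card hsub
    _ ≤ (univ ×ˢ X).card := card_image_le
    _ = Fintype.card {μν : Fin P.d × Fin P.d // μν.1 < μν.2} * X.card := by rw [card_product, card_univ]

open scoped Classical in
/-- **THE FINE REGION OF A LEVEL-`k` SITE HAS AT MOST `#pairs·(2k+1)^d·L^{dk}` PLAQUETTES**: the fine plaquettes `q` whose `k`-fold block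
`blockIter k q₋` is within coordinatewise offset `k` of `y ∈ T^{(k)}` (standing range). [cite: Balaban1987RG1, (0.1)-(0.3) pp.251-252] -/
theorem card_region_le {k : ℕ} (hk : k ≤ P.m + P.K) (y : Site P k) :
    (univ.filter (fun q : Plaq P 0 => ∀ κ, ∃ t : ℤ, |t| ≤ (k : ℤ) ∧
        blockIter k q.src κ = y κ + (t : ZMod (P.sitesPerDir k)))).card ≤
      Fintype.card {μν : Fin P.d × Fin P.d // μν.1 < μν.2} * ((2 * k + 1) ^ P.d * P.L ^ (P.d * k)) := by
  classical
  set B : Finset (Site P k) := univ.filter (fun z : Site P k => ∀ κ, ∃ t : ℤ, |t| ≤ (k : ℤ) ∧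
    z κ = y κ + (t : ZMod (P.sitesPerDir k))) with hB
  set X : Finset (Site P 0) := univ.filter (fun x : Site P 0 => blockIter k x ∈ B) with hX
  have hXcard : X.card ≤ (2 * k + 1) ^ P.d * P.L ^ (P.d * k) := by
    have hmaps : ((X : Finset (Site P 0)) : Set (Site P 0)).MapsTo (blockIter k) B := by
      intro x hx
      rw [Finset.mem_coe, hX, mem_filter] at hx
      exact hx.2
    rw [card_eq_sum_card_fiberwise hmaps]
    have hfib : ∀ w ∈ B, (X.filter (fun x => blockIter k x = w)).card = P.L ^ (P.d * k) := by
      intro w hw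
      rw [← card_fibre_blockIter k hk w]
      congr 1
      ext x
      simp only [hX, mem_filter, mem_univ, true_and]
      constructor
      · exact fun h => h.2
      · intro h; exact ⟨by rw [h]; exact hw, h⟩
    rw [sum_congr rfl hfib, sum_const, smul_eq_mul]
    exact Nat.mul_le_mul_right _ (card_near_le y k)
  have heq : univ.filter (fun q : Plaq P 0 => ∀ κ, ∃ t : ℤ, |t| ≤ (k : ℤ) ∧
      blockIter k q.src κ = y κ + (t : ZMod (P.sitesPerDir k))) = univ.filter (fun q : Plaq P 0 => q.src ∈ X) := by
    ext q
    simp only [hX, hB, mem_filter, mem_univ, true_and]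
  rw [heq]
  exact (card_plaq_src_mem_le X).trans (Nat.mul_le_mul_left _ hXcard)

open scoped Classical in
/-- **A FINE PLAQUETTE LIES IN THE REGIONS OF AT MOST `#pairs·(2k+1)^d` LEVEL-`k` PLAQUETTES** (the fibre multiplicity of the transfer).
[cite: Balaban1987RG1, (0.1)-(0.3) pp.251-252] -/
theorem card_multiplicity_le {k : ℕ} (q : Plaq P 0) :
    (univ.filter (fun p : Plaq P k => ∀ κ, ∃ t : ℤ, |t| ≤ (k : ℤ) ∧
        blockIter k q.src κ = p.src κ + (t : ZMod (P.sitesPerDir k)))).card ≤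
      Fintype.card {μν : Fin P.d × Fin P.d // μν.1 < μν.2} * (2 * k + 1) ^ P.d := by
  classical
  set Y : Finset (Site P k) := univ.filter (fun z : Site P k => ∀ κ, ∃ t : ℤ, |t| ≤ (k : ℤ) ∧
    z κ = blockIter k q.src κ + (t : ZMod (P.sitesPerDir k))) with hY
  have hsub : univ.filter (fun p : Plaq P k => ∀ κ, ∃ t : ℤ, |t| ≤ (k : ℤ) ∧
      blockIter k q.src κ = p.src κ + (t : ZMod (P.sitesPerDir k))) ⊆ univ.filter (fun p : Plaq P k => p.src ∈ Y) := by
    intro p hp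
    rw [mem_filter] at hp
    simp only [hY, mem_filter, mem_univ, true_and]
    exact near_symm hp.2
  exact (card_le_card hsub).trans ((card_plaq_src_mem_le Y).trans (Nat.mul_le_mul_left _ (card_near_le _ k)))

end Counting

/-! ## §2 The abstract union bound -/

section Transfer

variable {Ω : Type*} [MeasurableSpace Ω] {α β : Type*} [Fintype α] [Fintype β] [DecidableEq α] [DecidableEq β]

/-- **THE TRANSFER UNION BOUND.**  Let `μ` be a finite measure, `A a` (`a ∈ α`) and `B q` (`q ∈ β`) events, `Rel` a relation such that
`ω ∈ A a` forces `ω ∈ B q` for some `q` related to `a`; suppose each `a` has at most `R` related `q`, each `q` is related to at most `M ≥ 1`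
members, and the `B`-events satisfy the joint bound `μ{∀ q ∈ T, B q} ≤ ρ^{#T/D}` for every finite `T` (`0 ≤ ρ ≤ 1`, `D > 0`).  Then for
every finite `S ⊆ α`: `μ{∀ a ∈ S, A a} ≤ R^{#S} · ρ^{#S/(DM)}` — sum over the choice functions `f ∈ S.pi(related)`; for each, the image family `T_f` has
`#T_f ≥ #S/M` (`Finset.card_le_mul_card_image`). [cite: FrohlichIsraelLiebSimon1978, Thm 4.1] -/
theorem measureReal_forall_le_of_transfer (μ : Measure Ω) [IsFiniteMeasure μ] (A : α → Set Ω) (B : β → Set Ω)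
    (Rel : α → β → Prop) [∀ a q, Decidable (Rel a q)]
    (hforce : ∀ ω a, ω ∈ A a → ∃ q, Rel a q ∧ ω ∈ B q)
    {R : ℕ} (hR : ∀ a, (univ.filter (fun q => Rel a q)).card ≤ R)
    {M : ℕ} (hM1 : 1 ≤ M) (hM : ∀ q, (univ.filter (fun a => Rel a q)).card ≤ M)
    {ρ : ℝ} (hρ0 : 0 ≤ ρ) (hρ1 : ρ ≤ 1) {D : ℝ} (hD : 0 < D)
    (htail : ∀ T : Finset β, μ.real {ω | ∀ q ∈ T, ω ∈ B q} ≤ ρ ^ ((T.card : ℝ) / D))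
    (S : Finset α) :
    μ.real {ω | ∀ a ∈ S, ω ∈ A a} ≤ (R : ℝ) ^ S.card * ρ ^ ((S.card : ℝ) / (D * M)) := by
  classical
  -- choice functions
  set Pf : Finset ((a : α) → a ∈ S → β) := S.pi (fun a => univ.filter (fun q => Rel a q)) with hPf
  have hcover : {ω | ∀ a ∈ S, ω ∈ A a} ⊆ ⋃ f ∈ Pf, {ω | ∀ (a : α) (h : a ∈ S), ω ∈ B (f a h)} := by
    intro ω hω
    have hch : ∀ (a : α) (ha : a ∈ S), ∃ q, Rel a q ∧ ω ∈ B q := fun a ha => hforce ω a (hω a ha)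
    choose g hg using hch
    refine Set.mem_iUnion₂.mpr ⟨fun a ha => g a ha, ?_, fun a ha => (hg a ha).2⟩
    rw [hPf, mem_pi]
    intro a ha
    exact mem_filter.mpr ⟨mem_univ _, (hg a ha).1⟩
  -- each choice function gives a fine family of size `≥ #S/M`
  have hterm : ∀ f ∈ Pf, μ.real {ω | ∀ (a : α) (h : a ∈ S), ω ∈ B (f a h)} ≤ ρ ^ ((S.card : ℝ) / (D * M)) := by
    intro f hf
    set T : Finset β := S.attach.image (fun a => f a.1 a.2) with hT
    have hsubT : {ω | ∀ (a : α) (h : a ∈ S), ω ∈ B (f a h)} ⊆ {ω | ∀ q ∈ T, ω ∈ B q} := by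
      intro ω hω q hq
      obtain ⟨a, _, rfl⟩ := mem_image.mp hq
      exact hω a.1 a.2
    -- fibre bound: `#S ≤ M · #T`
    have hfib : S.card ≤ M * T.card := by
      rw [← card_attach]
      refine card_le_mul_card_image S.attach M (fun q _ => ?_)
      have hsub' : S.attach.filter (fun a => f a.1 a.2 = q) ⊆
          (univ.filter (fun a : α => Rel a q)).subtype (fun a => a ∈ S) := by
        intro a ha
        rw [mem_filter] at ha
        rw [mem_subtype, mem_filter]
        have hmem : f a.1 a.2 ∈ univ.filter (fun q => Rel a.1 q) := by
          rw [hPf, mem_pi] at hf; exact hf a.1 a.2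
        rw [mem_filter, ha.2] at hmem
        exact ⟨mem_univ _, hmem.2⟩
      calc (S.attach.filter (fun a => f a.1 a.2 = q)).card
          ≤ ((univ.filter (fun a : α => Rel a q)).subtype (fun a => a ∈ S)).card := card_le_card hsub'
        _ ≤ (univ.filter (fun a : α => Rel a q)).card := by rw [card_subtype]; exact card_filter_le _ _
        _ ≤ M := hM q
    have hexp : (S.card : ℝ) / (D * M) ≤ (T.card : ℝ) / D := by
      have hMpos : (0 : ℝ) < M := by exact_mod_cast hM1
      rw [mul_comm, ← div_div, div_le_div_iff_of_pos_right hD, div_le_iff₀ hMpos]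
      have : (S.card : ℝ) ≤ (M : ℝ) * T.card := by exact_mod_cast hfib
      linarith [mul_comm (M : ℝ) T.card]
    calc μ.real {ω | ∀ (a : α) (h : a ∈ S), ω ∈ B (f a h)} ≤ μ.real {ω | ∀ q ∈ T, ω ∈ B q} :=
        measureReal_mono hsubT (measure_ne_top μ _)
      _ ≤ ρ ^ ((T.card : ℝ) / D) := htail T
      _ ≤ ρ ^ ((S.card : ℝ) / (D * M)) := Real.rpow_le_rpow_of_exponent_ge' hρ0 hρ1 (by positivity) hexp
  -- sum over the choice functions
  have hPfcard : (Pf.card : ℝ) ≤ (R : ℝ) ^ S.card := by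
    have h1 : Pf.card ≤ R ^ S.card := by
      rw [hPf, card_pi]
      exact prod_le_pow_card S _ R (fun a _ => hR a)
    exact_mod_cast h1
  calc μ.real {ω | ∀ a ∈ S, ω ∈ A a}
      ≤ μ.real (⋃ f ∈ Pf, {ω | ∀ (a : α) (h : a ∈ S), ω ∈ B (f a h)}) :=
        measureReal_mono hcover (measure_ne_top μ _)
    _ ≤ ∑ f ∈ Pf, μ.real {ω | ∀ (a : α) (h : a ∈ S), ω ∈ B (f a h)} := measureReal_biUnion_finset_le Pf _
    _ ≤ ∑ f ∈ Pf, ρ ^ ((S.card : ℝ) / (D * M)) := sum_le_sum hterm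
    _ = Pf.card * ρ ^ ((S.card : ℝ) / (D * M)) := by rw [sum_const, nsmul_eq_mul]
    _ ≤ (R : ℝ) ^ S.card * ρ ^ ((S.card : ℝ) / (D * M)) :=
      mul_le_mul_of_nonneg_right hPfcard (Real.rpow_nonneg hρ0 _)

end Transfer

/-! ## §3 The joint Peierls bound for families of level-`j` averaged plaquettes -/

section Averaged

open Literature.MathematicalPhysics.QuantumFieldTheory.Balaban1983to89.T3FinestHeightJointTail (gibbsMeasure_real_forall_dist1_ge_le)

/-- **THE FINE-LEVEL JOINT TAIL AT A GENERAL THRESHOLD** for the cell's `SU(2)` families (`d = 3`, `N = 2`, `P₂ = 3`): there is an absolute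
`c ∈ (0, 1]` such that for every family `F`, coupling `γ`, cut-off `K` with `β_K ≥ 1`, threshold `ϑ ≥ 0` and EVERY finite family `T` of plaquettes
of the finest torus, `Gibbs_K{∀ q ∈ T, ϑ ≤ |U(∂q) − 1|} ≤ (min (2e^{24}(c³)⁻¹(√β_K)^9 e^{−β_Kϑ²/4}) 1)^{#T/3}` — the tree's joint Peierls–chessboard
tail (`T3FinestHeightJointTail.gibbsMeasure_real_forall_dist1_ge_le`, g9) read on `Gibbs_K`. [cite: FrohlichIsraelLiebSimon1978, Thm 4.1; Balaban1985UV3, (71) p.273] -/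
theorem gibbsK_real_forall_fine_ge_le :
    ∃ c : ℝ, 0 < c ∧ c ≤ 1 ∧ ∀ (F : T3Family) (γ : ℝ) (K : ℕ), 1 ≤ (F.scheme ℰp γ).β K → ∀ (ϑ : ℝ), 0 ≤ ϑ →
      ∀ T : Finset (Plaq (F.P K) 0),
        (gibbsK F ℰp γ K).real {U | ∀ q ∈ T, ϑ ≤ GaugeGroup.dist1 (GaugeField.plaqHol U q)} ≤
          (min (2 * Real.exp 24 * (c ^ 3)⁻¹ * Real.sqrt ((F.scheme ℰp γ).β K) ^ 9 *
              Real.exp (-((F.scheme ℰp γ).β K * ϑ ^ 2 / 4))) 1) ^ ((T.card : ℝ) / 3) := by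
  obtain ⟨c, hc, hc1, h⟩ := gibbsMeasure_real_forall_dist1_ge_le (N := 2)
  refine ⟨c, hc, hc1, fun F γ K hβ ϑ hϑ T => ?_⟩
  have hS := h (F.P K) ((F.scheme ℰp γ).β K) hβ ϑ hϑ T
  have hcard2 : Fintype.card {q : Fin (F.P K).d × Fin (F.P K).d // q.1 < q.2} = 3 := by
    rw [show (F.P K).d = 3 from rfl]; decide
  have hd3 : (F.P K).d = 3 := rfl
  rw [gibbsK_eq]
  refine hS.trans (le_of_eq ?_)
  rw [hcard2, hd3]
  norm_num

/-- The number of plaquette orientations `μ < ν` in `d = 3` is `3`. [folklore] -/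
theorem card_pairs_three (F : T3Family) (K : ℕ) : Fintype.card {μν : Fin (F.P K).d × Fin (F.P K).d // μν.1 < μν.2} = 3 := by
  rw [show (F.P K).d = 3 from rfl]; decide

open scoped Classical in
/-- **JOINT PEIERLS FOR FAMILIES OF LEVEL-`j` AVERAGED PLAQUETTES, RAW FORM.**  There is an absolute `c ∈ (0, 1]` such that for every family
`F`, coupling `γ` and cut-off `K` with `β_K ≥ 1`, every depth `j ≤ K`, every threshold `θ ≥ 0` with `((d+2)L)²θ/4 < δ₂` and EVERY finite
family `S` of plaquettes of `T^{(j)}`: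
`Gibbs_K{∀ a ∈ S, θ ≤ |Ū^j(∂a) − 1|} ≤ (3(2j+1)³L^{3j})^{#S} · (min (2e^{24}(c³)⁻¹(√β_K)^9 e^{−β_K(θ/C₁^j)²/4}) 1)^{#S/(3·3(2j+1)³)}`
(`C₁ = L² + 6((d+2)L)²`, `d = 3`) — file 1's transfer to fine plaquettes, §1's counts, §2's union bound and the fine joint tail.
[cite: Balaban1985Averaging, Prop. 1 (51) p.26; Balaban1985UV3, (71) p.273; FrohlichIsraelLiebSimon1978, Thm 4.1] -/
theorem gibbsK_real_forall_avg_ge_le :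
    ∃ c : ℝ, 0 < c ∧ c ≤ 1 ∧ ∀ (F : T3Family) (γ : ℝ), 0 ≤ γ → ∀ (K : ℕ), 1 ≤ (F.scheme ℰp γ).β K → ∀ (j : ℕ), j ≤ K →
      ∀ (θ : ℝ), 0 ≤ θ → ((((F.P K).d + 2) * (F.P K).L : ℕ) : ℝ) ^ 2 / 4 * θ < deltaSU (Fin 2) →
      ∀ S : Finset (Plaq (F.P K) j),
        (gibbsK F ℰp γ K).real {U | ∀ a ∈ S, θ ≤ GaugeGroup.dist1 (GaugeField.plaqHol
            (Averaging.iter (fun i => blockAvg (P := F.P K) (j := i) ℰp) j U) a)} ≤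
          ((3 * ((2 * j + 1) ^ 3 * (F.P K).L ^ (3 * j)) : ℕ) : ℝ) ^ S.card *
            (min (2 * Real.exp 24 * (c ^ 3)⁻¹ * Real.sqrt ((F.scheme ℰp γ).β K) ^ 9 *
                Real.exp (-((F.scheme ℰp γ).β K *
                  (θ / (((F.P K).L : ℝ) ^ 2 + 6 * ((((F.P K).d + 2) * (F.P K).L : ℕ) : ℝ) ^ 2) ^ j) ^ 2 / 4))) 1) ^
              ((S.card : ℝ) / (3 * ((3 * (2 * j + 1) ^ 3 : ℕ) : ℝ))) := by
  obtain ⟨c, hc, hc1, htail⟩ := gibbsK_real_forall_fine_ge_le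
  refine ⟨c, hc, hc1, fun F γ hγ K hβ j hjK θ hθ hguard S => ?_⟩
  haveI := isProbabilityMeasure_gibbsK F ℰp hγ K
  set C₁ : ℝ := ((F.P K).L : ℝ) ^ 2 + 6 * ((((F.P K).d + 2) * (F.P K).L : ℕ) : ℝ) ^ 2 with hC₁
  have hC₁1 : 1 ≤ C₁ := one_le_C₁
  have hC₁0 : 0 < C₁ := one_pos.trans_le hC₁1
  set a : ℝ := θ / C₁ ^ j with hadef
  have ha : 0 ≤ a := div_nonneg hθ (pow_nonneg hC₁0.le _)
  have hCa : C₁ ^ j * a = θ := by rw [hadef]; field_simp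
  have hjmK : j ≤ (F.P K).m + (F.P K).K := by show j ≤ F.m + K; omega
  -- the guard of file 1 at smallness `a`
  have hguard' : ((((F.P K).d + 2) * (F.P K).L : ℕ) : ℝ) ^ 2 / 4 * (C₁ ^ (j - 1) * a) < deltaSU (Fin 2) := by
    refine lt_of_le_of_lt (mul_le_mul_of_nonneg_left ?_ (by positivity)) hguard
    calc C₁ ^ (j - 1) * a ≤ C₁ ^ j * a := mul_le_mul_of_nonneg_right (pow_le_pow_right₀ hC₁1 (Nat.sub_le j 1)) ha
      _ = θ := hCa
  -- the fine tail as `ρ^{#T/3}`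
  set ρ : ℝ := min (2 * Real.exp 24 * (c ^ 3)⁻¹ * Real.sqrt ((F.scheme ℰp γ).β K) ^ 9 *
      Real.exp (-((F.scheme ℰp γ).β K * a ^ 2 / 4))) 1 with hρ
  have hρ0 : 0 ≤ ρ := le_min (by positivity) zero_le_one
  have hρ1 : ρ ≤ 1 := min_le_right _ _
  have hT : ∀ T : Finset (Plaq (F.P K) 0), (gibbsK F ℰp γ K).real
      {U | ∀ q ∈ T, U ∈ {V : GaugeField (F.P K) 0 (Matrix.specialUnitaryGroup (Fin 2) ℂ) |
        a ≤ GaugeGroup.dist1 (GaugeField.plaqHol V q)}} ≤ ρ ^ ((T.card : ℝ) / 3) :=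
    fun T => htail F γ K hβ a ha T
  -- the transfer
  have hM1 : 1 ≤ 3 * (2 * j + 1) ^ 3 := Nat.one_le_iff_ne_zero.mpr (by positivity)
  have hmain := measureReal_forall_le_of_transfer (gibbsK F ℰp γ K)
    (fun p : Plaq (F.P K) j => {U : GaugeField (F.P K) 0 (Matrix.specialUnitaryGroup (Fin 2) ℂ) |
      θ ≤ GaugeGroup.dist1 (GaugeField.plaqHol (Averaging.iter (fun i => blockAvg (P := F.P K) (j := i) ℰp) j U) p)})
    (fun q : Plaq (F.P K) 0 => {V : GaugeField (F.P K) 0 (Matrix.specialUnitaryGroup (Fin 2) ℂ) |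
      a ≤ GaugeGroup.dist1 (GaugeField.plaqHol V q)})
    (fun (p : Plaq (F.P K) j) (q : Plaq (F.P K) 0) => ∀ κ, ∃ t : ℤ, |t| ≤ (j : ℤ) ∧
      blockIter j q.src κ = p.src κ + (t : ZMod ((F.P K).sitesPerDir j)))
    (fun U p hU => by
      have h := exists_fine_ge_of_le_dist1_iter (n := Fin 2) j hjmK ha hguard' U p (by rw [hCa]; exact hU)
      exact h)
    (R := 3 * ((2 * j + 1) ^ 3 * (F.P K).L ^ (3 * j)))
    (fun p => by
      have h := card_region_le (P := F.P K) hjmK p.src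
      rw [card_pairs_three] at h
      exact h)
    (M := 3 * (2 * j + 1) ^ 3) hM1
    (fun q => by
      have h := card_multiplicity_le (P := F.P K) (k := j) q
      rw [card_pairs_three] at h
      exact h)
    hρ0 hρ1 (D := 3) three_pos hT S
  simpa [hρ, hadef] using hmain

end Averaged

end Summit.QuantumFields.YangMills.Theorems.CoarseStiffnessTailAveragedJointPeierls

end
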